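import Literature.IUT.HodgeArakelov.TemperedThetaMonoidsExample32AtTateTowerTheta
import Literature.AnabelianGeometry.EtaleTheta.LogDivisorModelTateTowerThetaTwistConstants
import Mathlib.NumberTheory.Padics.PadicIntegers
import HarnessLib

/-!
# [IUTchII] Example 3.2 at the `Ÿ`-skeleton WITH A CONSTANT FIELD ADJOINED: non-torsion units `O^×_{C^Θ_v}`
# (abc-iut cell, layer L6; L-F register row LF6-01, F-2568 — the «VNEXT» of the genuine instance; proof-only, no definitions)

S. Mochizuki, *Inter-universal Teichmüller theory II*, kurims manuscript (Dec. 2020), §3, Example 3.2 (i)–(ii),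
pp. 88–89 [claim: Mochizuki2012, status: disputed] (IUTchII §3 Ex 3.2, kurims p.88 l.55–83, p.89 l.2–27, l.59–65): "we
obtain submonoids [in the usual sense] `Ψ_{F^Θ_v,id} := O^▷_{C^Θ_v}(A^Θ_∞) = O^×_{C^Θ_v}(A^Θ_∞)·Θ_v|^ℕ_{A^Θ_∞} ⊆ ∞Ψ_{F^Θ_v,id} :=
O^×_{C^Θ_v}(A^Θ_∞)·Θ_v|^{ℚ≥0}_{A^Θ_∞} ⊆ O^×(T^÷_{A^Θ_∞})` … one has a natural surjection `Π_v ↠ Aut_{D_v}(Ÿ_v)`, as well as a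
natural conjugation action of `Π_v` on the collections of submonoids … `Θ^{ℚ≥0}_v|_{A^Θ_∞}` determines characteristic
splittings, up to torsion, of the monoids `Ψ_{F^Θ_v,α}` …, `∞Ψ_{F^Θ_v,α}` which are compatible with the action of `Π_v`";
(ii) "we obtain a monoid [in the usual sense] `Ψ_{C_v} := O^▷_{C_v}(A^Θ_∞)` which is equipped with a natural action by `Π_v`".

CONTEXT. `example32Statements_tateTowerTheta` (p495849) proves abc-iut-L6-t2's typed `Example32Statements` at the
GENUINE datum read off abc-iut-L2-t3's `Ÿ`-skeleton `TateTowerTheta.model`, all five binders of the closer of record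
`example32Statements_of_val` discharged — with the disclosed defect that the skeleton has NO constant field: there
`O^×_{C^Θ_v} = μ₂` is TORSION, so "characteristic splittings, UP TO TORSION" in (i) holds a fortiori. THIS FILE removes
that defect WITHOUT a new definition, over abc-iut-L2-t3's Kummer-LEVEL function groups (defined for EVERY additive
commutative group `B` of constants; finiteness of `B` enters only their `LogDivisorModel` records, unused here):
* functions `TateTowerThetaTwist.Fn (Multiplicative B) = Multiplicative B × Fn(Ÿ-skeleton)` — a constant group `B`
  (e.g. `B = Additive ℤ_[p]ˣ`, genuine `p`-adic units) adjoined to `μ₂ × ⟨ϖ̈⟩ × ⟨Ü⟩ × ⟨Θ̈⟩`; divisor through the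
  skeleton part `skel` (constants have trivial divisor, [EtTh] Prop. 3.2 (ii));
* `Π_v` acts on the constants through any `ψ : G → Aut(B)` ("through `Π_v ↠ G_v`", `constAction`, [EtTh] Def. 3.3 (iii))
  and on the skeleton through a character `φ : G → ℤ = Gal(Ÿ/X)` by the translations `translAction η` (the functional
  equation `Θ̈ ↦ η^{a} ϖ̈^{−a²} Ü^{2a} Θ̈` of [EtTh] Prop. 1.4 (ii), root-of-unity correction `η ∈ B`, `η = −1` in print);
  they commute once `ψ(G)` fixes `η` (`σ(−1) = −1`), and `g ↦ constAction (ψ g) · translAction η (φ g)` is then the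
  conjugation action (`conj_map_mul`; written inline with `MonoidHom.mk'`);
* units `O^×_{C^Θ_v} := ker(divisor ∘ skel) = Multiplicative B × μ₂`, `theta := (1, Θ̈)`, base monoid
  `Ψ_{C_v} = O^▷ := (Multiplicative B × μ₂) · ϖ̈^ℕ` (`intConstants.comap skel`).
RESULTS: **`example32Statements_constantField`** (every `G ψ φ η` with `ψ(G)` fixing `η`; `hU hB v hv hθ` ALL DISCHARGED:
constant automorphisms and the shear preserve "trivial divisor" / "integral constant", `v` = order at a cusp through
`skel`, `ord_cusp Θ̈ = 1`), hypothesis-free corollaries `…_signFree` (`η = 0`) and `…_translation` (constants fixed), and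
the point of the file **`exists_unit_not_isOfFinOrder`**: `O^×_{C^Θ_v}` is NOT torsion as soon as `B` has an element of
infinite order — instances `B = ℤ` and `B = Additive ℤ_[p]ˣ` (`1 + p` has infinite order) — so "up to torsion" in (i) is
no longer automatic. HONEST WORDS: an instance at OUR combinatorial level over the `Ÿ`-skeleton (exponent bookkeeping
of [EtTh] Prop. 1.4 with a constant group adjoined), NOT the formal scheme / the tempered Frobenioid of a Tate curve;
with `η = 0` the sign `(−1)^a` of Prop. 1.4 (ii) is dropped (immaterial for monoids modulo units); L2-t3's / L6-t2's
files consumed BY NAME, nothing restated. No side taken on [IUTchIII] Cor. 3.12; typed ≠ proved; an instance at OUR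
model is not the print universal closure; nothing here asserts abc proved or refuted. [claim: Mochizuki2012, status:
disputed] for the IUT sentences quoted; the mathematics is [EtTh] bookkeeping [cite: MochizukiEtTh2009, Prop 1.4 p.21].
-/

namespace Literature.IUT.HodgeArakelov

namespace TemperedThetaMonoids

open Literature.AnabelianGeometry.EtaleTheta
open Literature.AnabelianGeometry.EtaleTheta.LogDivisorModel
open Literature.AnabelianGeometry.EtaleTheta.LogDivisorModel.TateTowerTheta
open Literature.AnabelianGeometry.EtaleTheta.LogDivisorModel.TateTowerThetaTwist
open Multiplicative

variable {B : Type} [AddCommGroup B]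
variable {G : Type} [Group G]

/-! ### 1. The conjugation action: constants through `G_v`, the skeleton through the deck translations -/

/-- An automorphism `u` of the constants fixing the correction root `η` commutes with the `η`-corrected translation
`T^η_a` ([EtTh] Def. 3.3 (iii): the constant-field automorphisms and the translations `ℤ` act jointly; `C_u T^η_a =
T^{u η}_a C_u`, abc-iut-L2-t3's `constAut_translAut`). [cite: MochizukiEtTh2009, Def 3.3 p.73] -/
theorem constAction_mul_translAction_of_apply_eq (η : B) {u : MulAut (Multiplicative B)}
    (hu : u (ofAdd η) = ofAdd η) (a : Multiplicative ℤ) :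
    constAction u * translAction η a = translAction η a * constAction u := by
  refine MulEquiv.ext fun x => ?_
  rw [MulAut.mul_apply, MulAut.mul_apply, translAction_apply, translAction_apply, constAction_apply',
    constAction_apply']
  refine Prod.ext ?_ ?_
  · rw [translAut_fst, translAut_fst, map_mul, corr, ofAdd_zsmul, map_zpow, hu]
  · rw [translAut_snd, translAut_snd]

/-- **The conjugation action of `Π_v` is a homomorphism**: `g ↦ C_{ψ g} · T^η_{φ g}` is multiplicative once `ψ(G)`
fixes `η` — the multiplicativity input of `MonoidHom.mk'` in the Example 3.2 datum below (no definition introduced).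
[cite: MochizukiEtTh2009, Def 3.3 p.73] -/
theorem conj_map_mul (η : B) (ψ : G →* MulAut (Multiplicative B)) (hψ : ∀ g, ψ g (ofAdd η) = ofAdd η)
    (φ : G →* Multiplicative ℤ) (g h : G) :
    constAction (ψ (g * h)) * translAction η (φ (g * h)) =
      constAction (ψ g) * translAction η (φ g) * (constAction (ψ h) * translAction η (φ h)) := by
  rw [map_mul ψ, map_mul φ, map_mul constAction, map_mul (translAction η), mul_assoc, mul_assoc,
    ← mul_assoc (constAction (ψ h)), constAction_mul_translAction_of_apply_eq η (hψ h) (φ g), mul_assoc]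

/-! ### 2. The units `O^×_{C^Θ_v} = B × μ₂` and the base monoid `O^▷ = (B × μ₂) · ϖ̈^ℕ` -/

/-- A function `(ζ, f)` of the level has trivial divisor iff its skeleton part has: `c = k = t = 0` — the constant
`ζ ∈ B` is free ("units of `O_L` have trivial divisor", [EtTh] Prop. 3.2 (ii)). [cite: MochizukiEtTh2009, Prop 3.2 p.70] -/
theorem mem_ker_divHom_skel_iff (x : Fn (Multiplicative B)) :
    x ∈ (divHom.comp (skel (Multiplicative B))).ker ↔
      eC (toAdd x.2) = 0 ∧ eU (toAdd x.2) = 0 ∧ eT (toAdd x.2) = 0 := by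
  rw [MonoidHom.mem_ker, MonoidHom.comp_apply, ← MonoidHom.mem_ker]
  exact mem_ker_divHom_iff x.2

/-- Every constant `ζ ∈ B` is a unit of `O^×_{C^Θ_v}`. [cite: MochizukiEtTh2009, Prop 3.2 p.70] -/
theorem zeta_mem_ker_divHom_skel (ζ : Multiplicative B) :
    zeta (Multiplicative B) ζ ∈ (divHom.comp (skel (Multiplicative B))).ker := by
  rw [MonoidHom.mem_ker, MonoidHom.comp_apply]
  exact map_one divHom

/-- **`O^×_{C^Θ_v}` IS NOT A TORSION GROUP** as soon as the constant group has an element `b` of infinite order: the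
constant unit `(b, 1)` has infinite order. This is what makes "characteristic splittings, UP TO TORSION" in
Example 3.2 (i) a genuine statement at this datum (contrast `isOfFinOrder_of_mem_units` at the bare skeleton).
[claim: Mochizuki2012, status: disputed] (IUTchII §3 Ex 3.2 (i), kurims p.89) [cite: MochizukiEtTh2009, Prop 3.2 p.70] -/
theorem exists_unit_not_isOfFinOrder {b : B} (hb : ¬ IsOfFinAddOrder b) :
    ∃ u ∈ (divHom.comp (skel (Multiplicative B))).ker, ¬ IsOfFinOrder u := by
  refine ⟨zeta (Multiplicative B) (ofAdd b), zeta_mem_ker_divHom_skel (ofAdd b), fun h => hb ?_⟩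
  have h1 : IsOfFinOrder (ofAdd b) := (MonoidHom.fst (Multiplicative B) TateTowerTheta.model.Fn).isOfFinOrder h
  exact isOfFinOrder_ofAdd_iff.1 h1

/-! ### 3. The order of the divisor at a cusp, through the skeleton -/

/-- "The order of the divisor" at a cusp ([IUTchI] Ex. 3.2 (v)) on the functions of the level, read through the
skeleton part: a homomorphism to the ORDERED group `ℤ` killing `O^×_{C^Θ_v}` and positive on `Θ̈` (simple zeros of `Θ̈`
at the cusps, [EtTh] Prop. 1.4 (i)) — the inputs `(v, hv, hθ)` of `example32Statements_of_val`. [cite: MochizukiEtTh2009, Prop 1.4 p.21] -/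
theorem exists_cuspOrder_skel :
    ∃ v : Fn (Multiplicative B) →* Multiplicative ℤ,
      (∀ u ∈ (divHom.comp (skel (Multiplicative B))).ker, v u = 1) ∧ 1 < v (theta (Multiplicative B)) := by
  obtain ⟨v, -, hv, hθ⟩ := exists_cuspOrder
  refine ⟨v.comp (skel (Multiplicative B)), fun u hu => ?_, hθ⟩
  rw [MonoidHom.comp_apply]
  refine hv _ ?_
  rwa [MonoidHom.mem_ker, ← MonoidHom.comp_apply]

/-! ### 4. Example 3.2 at the skeleton with constants -/

/-- **F-2568 / IUTchII:Ex3.2 AT THE `Ÿ`-SKELETON WITH A CONSTANT GROUP `B` ADJOINED** — for every group `G`, every action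
`ψ` of `G` on the constants ("through `Π_v ↠ G_v`"), every character `φ : G → ℤ = Gal(Ÿ/X)` and every root-of-unity
correction `η` fixed by `ψ(G)`: the Example 3.2 statements (characteristic splittings up to torsion of every
`∞Ψ_{F^Θ,α}`, compatible with the conjugation action; `Π_v`-stability of `O^×_{C^Θ_v}` and of `Ψ_{C_v}`) hold for the
datum `⟨B × Fn(skeleton), g ↦ C_{ψ g}·T^η_{φ g}, ker(divisor ∘ skel), (1, Θ̈), O^▷⟩, by the closer of record
`example32Statements_of_val` with `hU hB v hv hθ` ALL DISCHARGED. Residual binders BY NAME: none (`hψ` is the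
compatibility `σ(η) = η` making the action a homomorphism; it is vacuous for `η = 0` and for constants fixed by `G`,
see the two corollaries). [claim: Mochizuki2012, status: disputed] (IUTchII §3 Ex 3.2 (i)(ii), kurims pp.88–89)
[cite: MochizukiEtTh2009, Def 3.3 p.73] -/
theorem example32Statements_constantField (η : B) (ψ : G →* MulAut (Multiplicative B))
    (hψ : ∀ g, ψ g (ofAdd η) = ofAdd η) (φ : G →* Multiplicative ℤ) :
    Example32Statements
      (⟨CommGrpCat.of (Fn (Multiplicative B)),
        MonoidHom.mk' (fun g => constAction (ψ g) * translAction η (φ g)) (conj_map_mul η ψ hψ φ),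
        (divHom.comp (skel (Multiplicative B))).ker, theta (Multiplicative B),
        intConstants.comap (skel (Multiplicative B))⟩ : TemperedFrobenioidThetaData.{0, 0} G) := by
  obtain ⟨v, hv, hθ⟩ := exists_cuspOrder_skel (B := B)
  refine example32Statements_of_val _ (Γ := Multiplicative ℤ) ?_ ?_ v hv hθ
  · -- `O^×_{C^Θ_v}` is `Π_v`-stable: constants go to constants, and the shear fixes a trivial-divisor skeleton part
    intro g x hx
    change (constAction (ψ g) * translAction η (φ g)) x ∈ (divHom.comp (skel (Multiplicative B))).ker
    obtain ⟨hc, hk, ht⟩ := (mem_ker_divHom_skel_iff x).1 hx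
    have h2 : shear₀Fn (toAdd (φ g)) x.2 = x.2 := toAdd.injective (shear₀_eq_self_of_const _ hk ht)
    rw [mem_ker_divHom_skel_iff, MulAut.mul_apply, translAction_apply, constAction_apply', translAut_snd, h2]
    exact ⟨hc, hk, ht⟩
  · -- `Ψ_{C_v} = O^▷` is `Π_v`-stable, for the same reason
    intro g x hx
    change (constAction (ψ g) * translAction η (φ g)) x ∈ intConstants.comap (skel (Multiplicative B))
    have hx' : x.2 ∈ intConstants := hx
    have h2 : shear₀Fn (toAdd (φ g)) x.2 = x.2 := toAdd.injective (shear₀_eq_self_of_const _ hx'.2.1 hx'.2.2)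
    rw [Submonoid.mem_comap, MulAut.mul_apply, translAction_apply, constAction_apply']
    change (translAut η (toAdd (φ g)) x).2 ∈ intConstants
    rw [translAut_snd, h2]
    exact hx'

/-- **Sign-free form** (`η = 0`): for EVERY action `ψ` of `G` on the constants and every character `φ`, no hypothesis.
[claim: Mochizuki2012, status: disputed] (IUTchII §3 Ex 3.2, kurims pp.88–89) [cite: MochizukiEtTh2009, Def 3.3 p.73] -/
theorem example32Statements_constantField_signFree (ψ : G →* MulAut (Multiplicative B)) (φ : G →* Multiplicative ℤ) :
    Example32Statements
      (⟨CommGrpCat.of (Fn (Multiplicative B)),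
        MonoidHom.mk' (fun g => constAction (ψ g) * translAction (0 : B) (φ g))
          (conj_map_mul 0 ψ (fun g => by rw [ofAdd_zero, map_one]) φ),
        (divHom.comp (skel (Multiplicative B))).ker, theta (Multiplicative B),
        intConstants.comap (skel (Multiplicative B))⟩ : TemperedFrobenioidThetaData.{0, 0} G) :=
  example32Statements_constantField 0 ψ (fun g => by rw [ofAdd_zero, map_one]) φ

/-- **Translation form** (constants fixed by `G`, every correction `η` — e.g. `η = −1`, the sign of [EtTh] Prop. 1.4 (ii)):
no hypothesis. [claim: Mochizuki2012, status: disputed] (IUTchII §3 Ex 3.2, kurims pp.88–89) [cite: MochizukiEtTh2009, Prop 1.4 p.22] -/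
theorem example32Statements_constantField_translation (η : B) (φ : G →* Multiplicative ℤ) :
    Example32Statements
      (⟨CommGrpCat.of (Fn (Multiplicative B)),
        MonoidHom.mk' (fun g => constAction ((1 : G →* MulAut (Multiplicative B)) g) * translAction η (φ g))
          (conj_map_mul η 1 (fun _ => rfl) φ),
        (divHom.comp (skel (Multiplicative B))).ker, theta (Multiplicative B),
        intConstants.comap (skel (Multiplicative B))⟩ : TemperedFrobenioidThetaData.{0, 0} G) :=
  example32Statements_constantField η 1 (fun _ => rfl) φ

/-! ### 5. Non-degeneracy: the theta function and the units at this datum -/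

/-- `Θ̈ = (1, Θ̈)` is not a unit: its divisor is non-trivial (cusp order `1`). [cite: MochizukiEtTh2009, Prop 1.4 p.21] -/
theorem theta_not_mem_ker_divHom_skel : theta (Multiplicative B) ∉ (divHom.comp (skel (Multiplicative B))).ker :=
  fun h => theta_not_mem_ker_divHom (by rwa [MonoidHom.mem_ker, MonoidHom.comp_apply, ← MonoidHom.mem_ker] at h)

/-- `Θ̈ ∉ Ψ_{C_v} = O^▷`. [cite: MochizukiEtTh2009, Prop 1.4 p.21] -/
theorem theta_not_mem_intConstants_comap :
    theta (Multiplicative B) ∉ intConstants.comap (skel (Multiplicative B)) :=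
  fun h => theta_not_mem_intConstants h

/-- The translation part MOVES `Θ̈` exactly when `φ g ≠ 1` — on the skeleton coordinate the action is the shear of
[EtTh] Prop. 1.4 (ii) (`Ü`-exponent `2a`), whatever the constants do. [cite: MochizukiEtTh2009, Prop 1.4 p.22] -/
theorem conj_theta_snd_eq_iff (η : B) (u : MulAut (Multiplicative B)) (a : Multiplicative ℤ) :
    ((constAction u * translAction η a) (theta (Multiplicative B))).2 = TateTowerTheta.theta ↔ a = 1 := by
  rw [MulAut.mul_apply, translAction_apply, constAction_apply', translAut_snd]
  change shear₀Fn (toAdd a) TateTowerTheta.theta = TateTowerTheta.theta ↔ a = 1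
  constructor
  · intro h
    have e := congrArg (fun f : Multiplicative Exp => eU (toAdd f)) h
    change eU (shear₀ (toAdd a) ((0, 0, 0, 1) : Exp)) = eU ((0, 0, 0, 1) : Exp) at e
    rw [eU_shear₀] at e
    change (0 : ℤ) + 2 * toAdd a * 1 = 0 at e
    have h0 : toAdd a = 0 := by omega
    rw [← ofAdd_toAdd a, h0, ofAdd_zero]
  · rintro rfl
    exact toAdd.injective (by rw [toAdd_shear₀Fn, toAdd_one]; exact shear₀_zero _)

/-! ### 6. Instances of the constant group: `ℤ` and the `p`-adic units `ℤ_[p]ˣ` -/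

/-- With constant group `B = ℤ` (one free unit direction), `O^×_{C^Θ_v} = ℤ × μ₂` is not torsion.
[cite: MochizukiEtTh2009, Prop 3.2 p.70] -/
theorem exists_unit_not_isOfFinOrder_int :
    ∃ u ∈ (divHom.comp (skel (Multiplicative ℤ))).ker, ¬ IsOfFinOrder u :=
  exists_unit_not_isOfFinOrder (not_isOfFinAddOrder_of_isAddTorsionFree (one_ne_zero (α := ℤ)))

/-- In the genuine `p`-adic ring of constants `ℤ_p`, the unit `1 + p` has infinite order (char. `0`).
[cite: MochizukiEtTh2009, §1 p.13] -/
theorem padicInt_one_add_p_not_isOfFinOrder (p : ℕ) [Fact p.Prime] :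
    ∃ u : ℤ_[p]ˣ, (u : ℤ_[p]) = 1 + p ∧ ¬ IsOfFinOrder u := by
  have hp1 : ‖(p : ℤ_[p])‖ < 1 := by
    rw [PadicInt.norm_p]
    exact inv_lt_one_of_one_lt₀ (by exact_mod_cast (Fact.out : p.Prime).one_lt)
  have hn : ‖(1 + p : ℤ_[p])‖ = 1 := by
    rw [PadicInt.norm_add_eq_max_of_ne (by rw [norm_one]; exact (ne_of_lt hp1).symm), norm_one,
      max_eq_left hp1.le]
  obtain ⟨u, hu⟩ := PadicInt.isUnit_iff.2 hn
  refine ⟨u, hu, fun hfin => ?_⟩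
  obtain ⟨n, hn0, hun⟩ := isOfFinOrder_iff_pow_eq_one.1 hfin
  have e : ((1 + p : ℕ) : ℤ_[p]) ^ n = 1 := by
    rw [Nat.cast_add, Nat.cast_one, ← hu, ← Units.val_pow_eq_pow_val, hun, Units.val_one]
  have e' : (1 + p) ^ n = 1 := by exact_mod_cast e
  have h3 : 1 + p ≤ (1 + p) ^ n := Nat.le_self_pow hn0.ne' (1 + p)
  have h2 : 2 ≤ p := (Fact.out : p.Prime).two_le
  omega

/-- With constant group the `p`-adic units `B = Additive ℤ_[p]ˣ` (`Multiplicative B ≅ ℤ_[p]ˣ`), `O^×_{C^Θ_v} = ℤ_[p]ˣ × μ₂`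
is not torsion: the constant unit `1 + p` has infinite order. [cite: MochizukiEtTh2009, Prop 3.2 p.70] -/
theorem exists_unit_not_isOfFinOrder_padicInt (p : ℕ) [Fact p.Prime] :
    ∃ u ∈ (divHom.comp (skel (Multiplicative (Additive ℤ_[p]ˣ)))).ker, ¬ IsOfFinOrder u := by
  obtain ⟨u₀, -, hu₀⟩ := padicInt_one_add_p_not_isOfFinOrder p
  exact exists_unit_not_isOfFinOrder (b := Additive.ofMul u₀) (by rwa [isOfFinAddOrder_ofMul_iff])

end TemperedThetaMonoids

end Literature.IUT.HodgeArakelov
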